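import Summits.ValiantsHypothesis.ValiantsHypothesis.Theorems.LacunarySymmetroidMatrixDescartesCensusSignatureLaw
import Summits.ValiantsHypothesis.ValiantsHypothesis.Theorems.LacunarySymmetroidMatrixDescartesCensusFullAlternation

/-!
# Tower graft line, `m = 2` row — the LETTER-RANK BUDGET: a `2 × 2` pencil with `K` letters of which `r` are
# non-singular has at most `C(K,2) + r` monomials in its determinant, hence at most `C(K,2) + r − 1` positive roots

Crux `stmt-ValiantsHypothesis-19561` (`Theses.KPlusLogSqLaw.WeakLifting`), line (B) `Cruxes/WeakLifting/Lines/tower_graft.lean`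
(registered stubs S4b `stub_graftLawCorner` / S4c rank-one grafts, S5 `stub_oneLetterGraftLaw`; the `m = 2` rung of record of the
hands leafhand-val-kpluslogsqlaw-1 g2–g4: `…TowerGraftRowTwoRung`, `…GraftFloorLemma`, tower records `9 / 13 / 16` at `K = 4 / 5 / 6`).

HONEST FRAMING.  A support-free Descartes budget in ONE row (`m = 2`) of the cell's table, by LETTER RANK; it proves nothing about
`WeakLifting`, Conjecture B / `KPlusLogSqLaw`, the registered stubs, `MatrixDescartes` (18050) or `VP ≠ VNP`.  Def-free helper.

For `2 × 2` real letters `S_l` (symmetric or not) the determinant of the pencil `∑_l X^{d_l} S_l` is the pair sum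
`∑_{l,l'} X^{d_l + d_l'} N_{l l'}` (`Census.det_pencil_two_eq_pairSum_X`), and the DIAGONAL pair coefficient is `N_{l l} = det S_l`.
Hence (`coeff_det_pencil_two`, `coeff_det_pencil_two_eq_zero`, `support_det_pencil_two_subset`):

* `card_support_det_pencil_two_le` — `#supp det ≤ C(K,2) + r`, `r = #{l : det S_l ≠ 0}`: a SINGULAR (isotropic, rank `≤ 1`)
  letter never creates the monomial `X^{2 d_l}`; only the `C(K,2)` cross exponents `d_l + d_{l'}` (`l < l'`) and the squares of the
  non-singular letters can occur;
* `card_posRoots_le_choose_two_add` — Descartes (`Census.card_posRoots_le_signVariations` + Literature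
  `signVariations_lt_card_support`): at most `C(K,2) + r − 1` distinct positive roots; `card_posRoots_le_of_isotropic` — ALL letters
  singular: at most `C(K,2) − 1` (`= 2` at `K = 3`, `= 5` at `K = 4`, `= 9` at `K = 5`, `= 14` at `K = 6`), against the Descartes
  ceiling `C(K+1,2) − 1 = 5 / 9 / 14 / 20` of the row;
* READING FOR THE LINE (`le_card_nonsingular_of_le_card_posRoots`, `all_nonsingular_of_nine_le`): a pencil with at least
  `C(K,2) + j` positive roots has at least `j + 1` NON-SINGULAR letters — so the kernel tower records of the line use `≥ 4 / 4 / 2`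
  non-singular letters at `K = 4 / 5 / 6` (the Descartes-sharp `K = 4` nine has ALL FOUR letters non-singular), and a rank-one graft
  (the S4b/S4c letter `t^D · e_i e_iᵀ`, singular: `det_vecMulVec_fin_two`) adds at most `K` monomials (`d_l + D`), never `X^{2D}` —
  the support-level reason behind the line's located count «one far rank-one letter buys at most `W + 1 ≤ K` roots».

[folklore] Descartes' rule of signs by monomial count; `2 × 2` determinant expansion.
-/

-- `Summit.ValiantsHypothesis.ValiantsHypothesis.…` repeats a component by the D-0017 layout
-- (single-conjunct summit), which the `dupNamespace` linter flags; the name is mandated.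
set_option linter.dupNamespace false
set_option autoImplicit false

namespace Summit.ValiantsHypothesis.ValiantsHypothesis.Theorems.KPlusLogSqLaw.TowerGraft.IsotropicLetters

open Polynomial Matrix Finset
open scoped BigOperators Polynomial Matrix
open Summit.ValiantsHypothesis.ValiantsHypothesis.Theorems.LacunarySymmetroidMatrixDescartes.Census
  (det_pencil_two_eq_pairSum_X card_posRoots_le_signVariations)

variable {K : ℕ}

/-- The coefficient of `X^e` in a `2 × 2` pencil determinant: the sum of the pair coefficients
`N_{l l'} = S_l 00 · S_{l'} 11 − S_l 01 · S_{l'} 10` over the pairs with `d_l + d_{l'} = e`. [folklore] -/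
theorem coeff_det_pencil_two (d : Fin K → ℕ) (S : Fin K → Matrix (Fin 2) (Fin 2) ℝ) (e : ℕ) :
    ((∑ l, (X : ℝ[X]) ^ d l • (S l).map C).det).coeff e =
      ∑ l, ∑ l', if e = d l + d l' then S l 0 0 * S l' 1 1 - S l 0 1 * S l' 1 0 else 0 := by
  rw [det_pencil_two_eq_pairSum_X, finsetSum_coeff]
  refine Finset.sum_congr rfl fun l _ => ?_
  rw [finsetSum_coeff]
  refine Finset.sum_congr rfl fun l' _ => ?_
  rw [X_pow_mul, coeff_C_mul_X_pow]

/-- The diagonal pair coefficient is the determinant of the letter: `N_{l l} = det S_l`. [folklore] -/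
theorem pairCoeff_self_eq_det (T : Matrix (Fin 2) (Fin 2) ℝ) :
    T 0 0 * T 1 1 - T 0 1 * T 1 0 = T.det := by
  rw [Matrix.det_fin_two]

/-- **Vanishing coefficients.**  If `e` is not a cross exponent `d_l + d_{l'}` (`l ≠ l'`) and every letter with `2 d_l = e` is
SINGULAR, then `X^e` does not occur in the determinant. [folklore] -/
theorem coeff_det_pencil_two_eq_zero (d : Fin K → ℕ) (S : Fin K → Matrix (Fin 2) (Fin 2) ℝ) (e : ℕ)
    (hcross : ∀ l l', l ≠ l' → d l + d l' ≠ e) (hsq : ∀ l, 2 * d l = e → (S l).det = 0) :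
    ((∑ l, (X : ℝ[X]) ^ d l • (S l).map C).det).coeff e = 0 := by
  rw [coeff_det_pencil_two]
  refine Finset.sum_eq_zero fun l _ => Finset.sum_eq_zero fun l' _ => ?_
  split_ifs with h
  · by_cases hll' : l = l'
    · subst hll'
      rw [pairCoeff_self_eq_det]
      exact hsq l (by omega)
    · exact absurd h.symm (hcross l l' hll')
  · rfl

/-- **Support of a `2 × 2` pencil determinant**: cross exponents of unordered pairs of letters, plus the squares `2 d_l` of the
NON-SINGULAR letters. [folklore] -/
theorem support_det_pencil_two_subset (d : Fin K → ℕ) (S : Fin K → Matrix (Fin 2) (Fin 2) ℝ) :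
    ((∑ l, (X : ℝ[X]) ^ d l • (S l).map C).det).support ⊆
      ((Finset.univ : Finset (Fin K)).powersetCard 2).image (fun s => ∑ l ∈ s, d l) ∪
        ((Finset.univ : Finset (Fin K)).filter (fun l => (S l).det ≠ 0)).image (fun l => 2 * d l) := by
  intro e he
  rw [mem_support_iff] at he
  by_contra hne
  apply he
  apply coeff_det_pencil_two_eq_zero
  · intro l l' hll' heq
    apply hne
    rw [Finset.mem_union]
    left
    rw [Finset.mem_image]
    refine ⟨{l, l'}, ?_, ?_⟩
    · rw [Finset.mem_powersetCard]
      exact ⟨Finset.subset_univ _, Finset.card_pair hll'⟩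
    · rw [Finset.sum_pair hll']
      exact heq
  · intro l h2
    by_contra hdet
    apply hne
    rw [Finset.mem_union]
    right
    rw [Finset.mem_image]
    exact ⟨l, Finset.mem_filter.mpr ⟨Finset.mem_univ _, hdet⟩, h2⟩

/-- **LETTER-RANK BUDGET (support).**  `#supp det(∑_l X^{d_l} S_l) ≤ C(K,2) + #{l : det S_l ≠ 0}`. [folklore] -/
theorem card_support_det_pencil_two_le (d : Fin K → ℕ) (S : Fin K → Matrix (Fin 2) (Fin 2) ℝ) :
    ((∑ l, (X : ℝ[X]) ^ d l • (S l).map C).det).support.card ≤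
      K.choose 2 + ((Finset.univ : Finset (Fin K)).filter (fun l => (S l).det ≠ 0)).card := by
  refine (Finset.card_le_card (support_det_pencil_two_subset d S)).trans ?_
  refine (Finset.card_union_le _ _).trans ?_
  refine Nat.add_le_add ?_ Finset.card_image_le
  refine Finset.card_image_le.trans ?_
  rw [Finset.card_powersetCard, Finset.card_univ, Fintype.card_fin]

/-- **LETTER-RANK BUDGET (roots).**  A `2 × 2` real pencil with `K` letters of which `r` are non-singular has at most
`C(K,2) + r − 1` distinct positive roots of its determinant (Descartes by monomial count). [folklore] -/
theorem card_posRoots_le_choose_two_add (d : Fin K → ℕ) (S : Fin K → Matrix (Fin 2) (Fin 2) ℝ) :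
    (((∑ l, (X : ℝ[X]) ^ d l • (S l).map C).det.roots.toFinset.filter (fun t => 0 < t)).card) ≤
      K.choose 2 + ((Finset.univ : Finset (Fin K)).filter (fun l => (S l).det ≠ 0)).card - 1 := by
  set f := (∑ l, (X : ℝ[X]) ^ d l • (S l).map C).det with hf
  by_cases h0 : f = 0
  · rw [h0, Polynomial.roots_zero]
    simp
  · have h1 := card_posRoots_le_signVariations f
    have h2 := Literature.Computability.AlgebraicComplexity.signVariations_lt_card_support h0
    have h3 := card_support_det_pencil_two_le d S
    rw [← hf] at h3
    omega

/-- **ISOTROPIC ROW.**  If EVERY letter is singular (rank `≤ 1`), the determinant has at most `C(K,2) − 1` distinct positive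
roots — `K` fewer monomials than the Descartes ceiling `C(K+1,2) − 1` of the `m = 2` row. [folklore] -/
theorem card_posRoots_le_of_isotropic (d : Fin K → ℕ) (S : Fin K → Matrix (Fin 2) (Fin 2) ℝ)
    (hiso : ∀ l, (S l).det = 0) :
    (((∑ l, (X : ℝ[X]) ^ d l • (S l).map C).det.roots.toFinset.filter (fun t => 0 < t)).card) ≤ K.choose 2 - 1 := by
  have h := card_posRoots_le_choose_two_add d S
  have hr : ((Finset.univ : Finset (Fin K)).filter (fun l => (S l).det ≠ 0)).card = 0 := by
    rw [Finset.card_eq_zero, Finset.filter_eq_empty_iff]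
    intro l _
    exact not_not.mpr (hiso l)
  rw [hr, Nat.add_zero] at h
  exact h

/-- Isotropic row, three letters: at most `2` positive roots (general letters reach `5 = C(4,2) − 1`, the census value `ζ(2,3)`). [folklore] -/
theorem card_posRoots_le_two_of_isotropic_three (d : Fin 3 → ℕ) (S : Fin 3 → Matrix (Fin 2) (Fin 2) ℝ)
    (hiso : ∀ l, (S l).det = 0) :
    (((∑ l, (X : ℝ[X]) ^ d l • (S l).map C).det.roots.toFinset.filter (fun t => 0 < t)).card) ≤ 2 :=
  card_posRoots_le_of_isotropic d S hiso

/-- Isotropic row, four letters: at most `5` positive roots (general letters reach `9 = C(5,2) − 1`, Descartes-sharp, also on the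
2-tower `(0,1,3,20)` — `…TowerRowTwoDescartesSharp`). [folklore] -/
theorem card_posRoots_le_five_of_isotropic_four (d : Fin 4 → ℕ) (S : Fin 4 → Matrix (Fin 2) (Fin 2) ℝ)
    (hiso : ∀ l, (S l).det = 0) :
    (((∑ l, (X : ℝ[X]) ^ d l • (S l).map C).det.roots.toFinset.filter (fun t => 0 < t)).card) ≤ 5 :=
  card_posRoots_le_of_isotropic d S hiso

/-- **Non-singular letters are necessary for many roots.**  If the determinant has at least `C(K,2) + j` distinct positive roots,
then at least `j + 1` letters are non-singular. [folklore] -/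
theorem le_card_nonsingular_of_le_card_posRoots (d : Fin K → ℕ) (S : Fin K → Matrix (Fin 2) (Fin 2) ℝ) (j : ℕ)
    (hK : 2 ≤ K)
    (hj : K.choose 2 + j ≤
      (((∑ l, (X : ℝ[X]) ^ d l • (S l).map C).det.roots.toFinset.filter (fun t => 0 < t)).card)) :
    j + 1 ≤ ((Finset.univ : Finset (Fin K)).filter (fun l => (S l).det ≠ 0)).card := by
  have h := card_posRoots_le_choose_two_add d S
  have hpos : 0 < K.choose 2 := Nat.choose_pos hK
  omega

/-- **The `K = 4` nines are rank-saturated.**  A `2 × 2` pencil with four letters and at least `9` distinct positive roots of its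
determinant (the Descartes-sharp `m = 2` cell, e.g. the line's 2-tower nine on `(0,1,3,20)`) has ALL FOUR letters non-singular. [folklore] -/
theorem all_nonsingular_of_nine_le (d : Fin 4 → ℕ) (S : Fin 4 → Matrix (Fin 2) (Fin 2) ℝ)
    (h9 : 9 ≤ (((∑ l, (X : ℝ[X]) ^ d l • (S l).map C).det.roots.toFinset.filter (fun t => 0 < t)).card)) :
    ∀ l, (S l).det ≠ 0 := by
  have h46 : Nat.choose 4 2 = 6 := by decide
  have h := le_card_nonsingular_of_le_card_posRoots d S 3 (by omega) (by omega)
  have hle : ((Finset.univ : Finset (Fin 4)).filter (fun l => (S l).det ≠ 0)).card ≤ 4 :=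
    (Finset.card_filter_le _ _).trans (by simp)
  have heq : ((Finset.univ : Finset (Fin 4)).filter (fun l => (S l).det ≠ 0)) = Finset.univ :=
    Finset.eq_univ_of_card _ (by rw [Fintype.card_fin]; omega)
  intro l
  have hl : l ∈ ((Finset.univ : Finset (Fin 4)).filter (fun l => (S l).det ≠ 0)) := by
    rw [heq]; exact Finset.mem_univ l
  exact (Finset.mem_filter.mp hl).2

/-- The `K = 5` tower thirteens (`…TowerRowTwoK5Tower`, `…K5Family`) use at least four non-singular letters. [folklore] -/
theorem four_le_card_nonsingular_of_thirteen_le (d : Fin 5 → ℕ) (S : Fin 5 → Matrix (Fin 2) (Fin 2) ℝ)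
    (h13 : 13 ≤ (((∑ l, (X : ℝ[X]) ^ d l • (S l).map C).det.roots.toFinset.filter (fun t => 0 < t)).card)) :
    4 ≤ ((Finset.univ : Finset (Fin 5)).filter (fun l => (S l).det ≠ 0)).card := by
  have h5 : Nat.choose 5 2 = 10 := by decide
  exact le_card_nonsingular_of_le_card_posRoots d S 3 (by omega) (by omega)

/-- The `K = 6` tower sixteens (`…TowerRowTwoK6Family`) use at least two non-singular letters. [folklore] -/
theorem two_le_card_nonsingular_of_sixteen_le (d : Fin 6 → ℕ) (S : Fin 6 → Matrix (Fin 2) (Fin 2) ℝ)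
    (h16 : 16 ≤ (((∑ l, (X : ℝ[X]) ^ d l • (S l).map C).det.roots.toFinset.filter (fun t => 0 < t)).card)) :
    2 ≤ ((Finset.univ : Finset (Fin 6)).filter (fun l => (S l).det ≠ 0)).card := by
  have h6 : Nat.choose 6 2 = 15 := by decide
  exact le_card_nonsingular_of_le_card_posRoots d S 1 (by omega) (by omega)

/-- The rank-one graft letter of the line (S4b/S4c: `v vᵀ`, in particular the corner `e_i e_iᵀ`) is singular. [folklore] -/
theorem det_vecMulVec_fin_two (v w : Fin 2 → ℝ) : (Matrix.vecMulVec v w).det = 0 := by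
  rw [Matrix.det_fin_two]
  simp only [Matrix.vecMulVec_apply]
  ring

end Summit.ValiantsHypothesis.ValiantsHypothesis.Theorems.KPlusLogSqLaw.TowerGraft.IsotropicLetters
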